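import Literature.NumberTheory.Automorphic.LanglandsTetrahedralJacquetShalikaLeaves
import Literature.NumberTheory.Automorphic.AutomorphicRepsGLCuspidalUnitaryHolds
import HarnessLib

/-!
# `JacquetShalika_eq_of_rsData_eq` (Gelbart 1997, Thm. 5.3.3 as used on p. 257) from the three
# analytic leaves: the Borel–Jacquet ↔ `L²` dictionary is discharged

Topic `NumberTheory/Automorphic`; namespace `Literature.NumberTheory.Automorphic`. Proof file
(theorems only: no definition, no named fact, no instance), fourth sibling of `LanglandsTetrahedral`
under the named fact `JacquetShalika_eq_of_rsData_eq` (two cuspidal automorphic representations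
`Π, Π'` of `GL_n(𝔸_F)` — Borel–Jacquet data, arbitrary central characters — whose local
Rankin–Selberg data `{α'_i / α_j} = {α_i / α_j}` agree at almost every place have the same Satake
parameters at almost every place; Gelbart, *Three lectures …*, in Cornell–Silverman–Stevens (1997),
Thm. 5.3.3 (Jacquet–Shalika 1981) in the form used in §7.1, p. 257: "by Theorem 5.3.3,
`L(s, Π₁ × Π̃₁)` has a pole at `s = 1` … therefore … `Π₁* ≅ Π₁`"), after `LanglandsTetrahedralProofs`,
`LanglandsTetrahedralLeaves` and `LanglandsTetrahedralJacquetShalikaLeaves`.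

`LanglandsTetrahedralJacquetShalikaLeaves` proved the fact from five named-fact leaves
(`JacquetShalika_eq_of_rsData_eq_of_realisation_leaves`): the continuity of
`L^S(s, π × σ)` at `s = 1` for `π ≇ σ̃` (Arthur–Clozel, Ch. 3, (2.2);
`JacquetShalika1981_partialPairL_at_one_of_ne_conj`), the pole of `L^S(s, π × π̃)` at `s = 1`
((2.3); `JacquetShalika1981_partialPairL_pole_of_eq_conj`), multiplicity one on `L²_cusp(GL_n)`
(`multiplicity_one_gl`), and two representation-theoretic leaves carrying Borel–Jacquet's
"we may assume `π` unitary" (Borel–Jacquet 1979, 4.6 and 5.7): the realisation of irreducible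
stable spaces of `A_G`-invariant cusp forms inside `L²_cusp`
(`AutomorphicRepsGL.exists_le_formsOfL2_of_W'_eq_bot`) and the semisimplicity of the space of
`A_G`-invariant cusp forms (`AutomorphicRepsGL.stable_cuspidal_eq_sSup_irreducible`,
Gelfand–Piatetski-Shapiro). Both of the latter are now THEOREMS of the tree —
`AutomorphicRepsGL.exists_le_formsOfL2_of_W'_eq_bot_holds` (`AutomorphicRepsGLIrreducibleL2HCHolds`:
Harish-Chandra's closure theorem and correspondence, with the cuspidal case of Harish-Chandra's
finiteness theorem) and `AutomorphicRepsGL.stable_cuspidal_eq_sSup_irreducible_holds`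
(`AutomorphicRepsGLCuspidalUnitaryHolds`: Knapp–Vogan's orthogonal decomposition of admissible
infinitesimally unitary modules) — so the dictionary disappears from the trust base:

* `CuspidalAutomorphicRepData.exists_satake_eq_cpow_mul_L2_of_holds` — **the unitary
  normalisation of every cuspidal Borel–Jacquet datum, unconditionally** (Borel–Jacquet 1979, 5.7:
  for cuspidal `π` on `GL_n(𝔸_K)`, `n ≥ 1`, there are `s ∈ ℂ`, an irreducible closed invariant
  `P ≤ L²_cusp` and a Satake family `α_P` of `P` off a finite `S` with `t_{π,w} = q_w^{s} α_P(w)`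
  exactly, for `w ∉ S`): `CuspidalAutomorphicRepData.exists_satake_eq_cpow_mul_L2_of_realisation`
  (`PairLFunctionPolesRepDataRealisation`) fed with the two discharges and the clean models of
  `AutomorphicRepsGLCleanModel`. (The same statement is obtained independently in
  `AutomorphicInductionCuspidalProofs` as `…_unconditional`; it is re-derived here in three lines to
  keep this file's imports inside the Jacquet–Shalika story.)
* `JacquetShalika_eq_of_rsData_eq_of_continuity_of_divergence` — **the fact from the minimal
  analytic input alone**: multiplicity one, the continuity half of (2.2) at `s = 1` for `π ≠ σ̄`
  (a finite limit of `L^S(s, π ⊗ σ)` from `re s > 1`), and the divergence half of (2.3) (no finite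
  limit of `L^S(s, π ⊗ π̄)` at `s = 1`); this is
  `JacquetShalika_eq_of_rsData_eq_of_normalisation_of_continuity_of_divergence` with its
  normalisation hypothesis discharged.
* `JacquetShalika_eq_of_rsData_eq_of_analytic_leaves` — **the fact from the three named analytic
  leaves** `JacquetShalika1981_partialPairL_at_one_of_ne_conj`, `…_pole_of_eq_conj`,
  `multiplicity_one_gl` (all ranks, all number fields, all automorphic measures). The discharge
  `JacquetShalika_eq_of_rsData_eq_holds` is this theorem applied to their three `_holds`.

Why these three remain (and cannot be traded for local combinatorics): the local shadow of the
statement is false (`rsData_triple_one_eq` of `LanglandsTetrahedral`: `{1, ζ, ζ²}` and `{1, 1, 1}`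
have the same Rankin–Selberg data against `{1, ζ, ζ²}`), so the global pole of `L(s, Π × Π̃)` at
`s = 1` and the holomorphy of `L(s, Π' × Π̃)` there for `Π' ≇ Π` are genuinely used, exactly as on
p. 257 of the source; and (2.2) is vendored relative to multiplicity one (its hypothesis
`P ≠ P'.conj` renders the printed `π ≇ σ̃` only under `multiplicity_one_gl`).

No statement of the tree is modified; nothing here restates or weakens a vendored fact; no named
fact is introduced.

## References

* S. Gelbart, *Three lectures on the modularity of `ρ̄_{E,3}` and the Langlands reciprocity
  conjecture*, in *Modular forms and Fermat's last theorem* (1997), Thm. 5.3.3, §7.1 pp. 254–257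
  [Gelbart1997].
* H. Jacquet, J. A. Shalika, *On Euler products and the classification of automorphic forms II*,
  Amer. J. Math. 103 (1981), 777–815, Prop. 3.6 [JacquetShalikaAJM1981II].
* J. Arthur, L. Clozel, *Simple algebras, base change, and the advanced theory of the trace
  formula*, Ann. of Math. Stud. 120 (1989), Ch. 3 §2 (2.2)–(2.3) and proof of Thm. 3.1
  [ArthurClozelAMS120].
* A. Borel, H. Jacquet, *Automorphic forms and automorphic representations*, Proc. Sympos. Pure
  Math. 33 (1979), part 1, §4.6 and 5.7 [BorelJacquetCorvallis1979].
* A. W. Knapp, D. A. Vogan, *Cohomological Induction and Unitary Representations* (1995), Ch. IX §1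
  [KnappVogan1995].
-/

noncomputable section

open scoped MatrixGroups NNReal Classical
open NumberField IsDedekindDomain MeasureTheory Filter Topology

namespace Literature.NumberTheory.Automorphic

open AdelicGroupData

/-! ### The unitary normalisation of a cuspidal Borel–Jacquet datum, unconditionally -/

section Normalisation

/-- **Borel–Jacquet 5.7 for cuspidal data on `GL_n(𝔸_K)`, unconditionally.** For a cuspidal
automorphic representation `π = W / W'` of `GL_n(𝔸_K)` in the sense of Borel–Jacquet (`n ≥ 1`,
arbitrary behaviour on `A_G`) and an automorphic measure `μ`, there are `s ∈ ℂ`, an irreducible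
closed invariant `P ≤ L²_cusp(GL_n(𝔸_K) ⧸ A_G GL_n(K), μ)`, a finite set `S` of finite places and
a Satake family `α_P` of `P` off `S` such that, for `w ∉ S`, the Satake parameters of `π` at `w`
are exactly `q_w^{s} α_P(w)` ("`π ⊗ |det|^{s}` is unitary for a suitable `s`, and unitary cuspidal
representations are realised in `L²_cusp`"). Proof:
`CuspidalAutomorphicRepData.exists_satake_eq_cpow_mul_L2_of_realisation` with the realisation
theorem `AutomorphicRepsGL.exists_le_formsOfL2_of_W'_eq_bot_holds` and the clean models
`CuspidalAutomorphicRepData.exists_clean_hasSatakeParamAt_of_sSup_irreducible` over the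
semisimplicity theorem `AutomorphicRepsGL.stable_cuspidal_eq_sSup_irreducible_holds`.
[cite: BorelJacquetCorvallis1979, §4.6 and 5.7] -/
theorem CuspidalAutomorphicRepData.exists_satake_eq_cpow_mul_L2_of_holds
    {n : ℕ} {K : Type} [Field K] [NumberField K] (hK : isCompact_glFiniteIntegralLevel n K)
    [NeZero n] (μ : Measure (gl n K).automorphicQuotient) [(gl n K).IsAutomorphicMeasure μ]
    (π : CuspidalAutomorphicRepData n K hK) :
    ∃ (s : ℂ) (P : CuspidalAutomorphicRepGL n K μ) (S : Set (HeightOneSpectrum (𝓞 K)))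
      (αP : SatakeFamily K), S.Finite ∧ IsSatakeFamilyOf P S αP ∧
      ∀ w ∉ S, ∀ β : Multiset ℂ,
        π.1.HasSatakeParamAt w β ↔ β = (αP w).map (((w.residueCard : ℂ) ^ s) * ·) :=
  CuspidalAutomorphicRepData.exists_satake_eq_cpow_mul_L2_of_realisation
    (fun _ _ _ => AutomorphicRepsGL.exists_le_formsOfL2_of_W'_eq_bot_holds)
    (fun _ _ π => CuspidalAutomorphicRepData.exists_clean_hasSatakeParamAt_of_sSup_irreducible
      AutomorphicRepsGL.stable_cuspidal_eq_sSup_irreducible_holds π) hK μ π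

end Normalisation

/-! ### The fact from the analytic input alone -/

section Analytic

/-- **`JacquetShalika_eq_of_rsData_eq` from the minimal analytic input.** Multiplicity one on
`L²_cusp(GL_n)` (`hm1`), the continuity half of Arthur–Clozel (2.2) at `s = 1` for `π ≠ σ̄` under
multiplicity one (`hcont`: a finite limit of `L^S(s, π ⊗ σ) = partialPairL S α β s` as `s → 1`,
`re s > 1`) and the divergence half of (2.3) (`hdiv`: no finite limit of `L^S(s, π ⊗ σ)` at `s = 1`
when `π = σ̄`) imply the named fact of `LanglandsTetrahedral`: this is
`JacquetShalika_eq_of_rsData_eq_of_normalisation_of_continuity_of_divergence` with its unitary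
normalisation discharged by `CuspidalAutomorphicRepData.exists_satake_eq_cpow_mul_L2_of_holds`.
In print (Gelbart, p. 257): equal local Rankin–Selberg data off a finite set give
`L^S(s, Π₁* × Π̃₁) = L^S(s, Π₁ × Π̃₁)`; the right side has a pole at `s = 1`, so the left side has
one, forcing `Π₁* ≅ Π₁` (Thm. 5.3.3), after the normalisation "we may assume `Π` unitary"
(Borel–Jacquet 5.7) and the comparison of central characters (the unitary shift vanishes,
`CuspidalAutomorphicRepGL.shift_eq_zero_of_satakeTensor_conj`).
[cite: Gelbart1997, Thm. 5.3.3 and §7.1 p. 257] [cite: ArthurClozelAMS120, Ch. 3 §2 (2.2)–(2.3)] -/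
theorem JacquetShalika_eq_of_rsData_eq_of_continuity_of_divergence
    (hm1 : ∀ (n : ℕ) (K : Type) [Field K] [NumberField K] (μ : Measure (gl n K).automorphicQuotient)
      [(gl n K).IsAutomorphicMeasure μ], multiplicity_one_gl n K μ)
    (hcont : ∀ {n : ℕ} {K : Type} [Field K] [NumberField K] {μ : Measure (gl n K).automorphicQuotient}
      [(gl n K).IsAutomorphicMeasure μ], ∀ (_hn : 0 < n) (_h₁ : multiplicity_one_gl n K μ)
      (P P' : CuspidalAutomorphicRepGL n K μ) (_hne : P ≠ P'.conj)
      {S : Set (HeightOneSpectrum (𝓞 K))} (_hS : S.Finite)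
      {α β : SatakeFamily K} (_hα : IsSatakeFamilyOf P S α) (_hβ : IsSatakeFamilyOf P' S β),
      ∃ c : ℂ, Tendsto (partialPairL S α β) (𝓝[{s : ℂ | 1 < s.re}] 1) (𝓝 c))
    (hdiv : ∀ {n : ℕ} {K : Type} [Field K] [NumberField K] {μ : Measure (gl n K).automorphicQuotient}
      [(gl n K).IsAutomorphicMeasure μ], ∀ (_hn : 0 < n) (P P' : CuspidalAutomorphicRepGL n K μ)
      (_he : P = P'.conj) {S : Set (HeightOneSpectrum (𝓞 K))} (_hS : S.Finite)
      {α β : SatakeFamily K} (_hα : IsSatakeFamilyOf P S α) (_hβ : IsSatakeFamilyOf P' S β)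
      (d : ℂ), ¬ Tendsto (partialPairL S α β) (𝓝[{s : ℂ | 1 < s.re}] 1) (𝓝 d)) :
    JacquetShalika_eq_of_rsData_eq :=
  JacquetShalika_eq_of_rsData_eq_of_normalisation_of_continuity_of_divergence hm1 hcont hdiv
    fun hK _ μ _ π => CuspidalAutomorphicRepData.exists_satake_eq_cpow_mul_L2_of_holds hK μ π

/-- **`JacquetShalika_eq_of_rsData_eq` from the three named analytic leaves** (all ranks, all
number fields, all automorphic measures): Arthur–Clozel (2.2) at `s = 1` for `π ≇ σ̃`
(`JacquetShalika1981_partialPairL_at_one_of_ne_conj`), (2.3)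
(`JacquetShalika1981_partialPairL_pole_of_eq_conj`) and multiplicity one (`multiplicity_one_gl`);
`JacquetShalika_eq_of_rsData_eq_of_realisation_leaves` of `LanglandsTetrahedralJacquetShalikaLeaves`
with its two representation-theoretic leaves discharged by
`AutomorphicRepsGL.exists_le_formsOfL2_of_W'_eq_bot_holds` and
`AutomorphicRepsGL.stable_cuspidal_eq_sSup_irreducible_holds`. The discharge
`JacquetShalika_eq_of_rsData_eq_holds` is this theorem applied to the three `_holds`.
[cite: Gelbart1997, Thm. 5.3.3 and §7.1 p. 257] [cite: ArthurClozelAMS120, Ch. 3 §2 (2.2)–(2.3)]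
[cite: BorelJacquetCorvallis1979, §4.6 and 5.7] -/
theorem JacquetShalika_eq_of_rsData_eq_of_analytic_leaves
    (h22 : ∀ {n : ℕ} {K : Type} [Field K] [NumberField K] {μ : Measure (gl n K).automorphicQuotient}
      [(gl n K).IsAutomorphicMeasure μ],
      JacquetShalika1981_partialPairL_at_one_of_ne_conj (n := n) (K := K) (μ := μ))
    (h23 : ∀ {n : ℕ} {K : Type} [Field K] [NumberField K] {μ : Measure (gl n K).automorphicQuotient}
      [(gl n K).IsAutomorphicMeasure μ],
      JacquetShalika1981_partialPairL_pole_of_eq_conj (n := n) (K := K) (μ := μ))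
    (hm1 : ∀ (n : ℕ) (K : Type) [Field K] [NumberField K] (μ : Measure (gl n K).automorphicQuotient)
      [(gl n K).IsAutomorphicMeasure μ], multiplicity_one_gl n K μ) :
    JacquetShalika_eq_of_rsData_eq :=
  JacquetShalika_eq_of_rsData_eq_of_realisation_leaves h22 h23 hm1
    (fun _ _ _ => AutomorphicRepsGL.exists_le_formsOfL2_of_W'_eq_bot_holds)
    fun _ => AutomorphicRepsGL.stable_cuspidal_eq_sSup_irreducible_holds

end Analytic

end Literature.NumberTheory.Automorphic
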